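/-
Copyright (c) 2026 the pub-hodgecm-mathlib formalisation cell (harness21).  Prover seat hodgecm-mathlib-K2E1-p13 (g5), Track B ∕ K2-LIT, h413 = `stmt-HodgeConjecture-24833`,
R90-TF section S8 «ContSpec-n½», S8 dealer R90-CS-plan (g3) S8-R192 ∕ S8-R203 (∞-2) «GENERAL BLOCKS: THE SHIFTED WITNESS», census `R90/S8/CENSUS-ArchSectionShiftedU3.K2E1-p13-g5.md`
51c4844f2a91ac38 — file (γ2): THE ARCHIMEDEAN HALF OF `hA32` FOR THE SHIFTED WEIGHT OF RECORD — EVERY ODD COUPLING EXPONENT `m_w` (over ★ (γ1) `K2E1ChiArchShiftedKernelIntegralU3` and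
the ★ (a-10) engine of R90-CS-p03).
-/
import Summits.HodgeConjecture.HodgeConjecture.Theorems.K2E1ChiArchShiftedKernelIntegralU3   -- ★ (γ1) (this seat): the exact kernel `∫ (2+ζ)^p∕(ζ ζ̄^{p+2}) = (−1)^{p+1}π∕(2A^{p+2}|β|)`
import Summits.HodgeConjecture.HodgeConjecture.Theorems.K2E1ChiArchNonvanishingOfRecordU3    -- ★ (a-10c) R90-CS-p03: `archUnitaryValue` at `t = 0` (brings ★ (a-10b) phase letters + ★ (a-10) ENGINE)
import HarnessLib

/-!
# K2·E1 ∕ R90·S8 — `K2E1ChiArchShiftedNonvanishingU3` (file (γ2) of (∞-2)): THE ARCHIMEDEAN FACTOR AT `z = 3∕2` IS NON-ZERO FOR THE SHIFTED WEIGHT OF RECORD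
# `∏_w ε_w·archUnitaryValue m_w 0 ζ_w·((2+ζ_w)∕ζ_w)^{p_w}·((2+conj ζ_w)∕conj ζ_w)^{q_w}`, `m_w = 2p_w + 1` or `m_w = −(2q_w + 1)` — EVERY ODD `m_w`

Cell `pub/hodgecm-mathlib`, crux h413 = `stmt-HodgeConjecture-24833`, route of record `HCCMUnconditional`; R90-TF section S8 «ContSpec-n½», road R2-χ₃ ((V)(iii) row `hA32 : A(3∕2) ≠ 0`
for GENERAL blocks, S8-R192 (∞-2): coupling exponents `|m_w| ≥ 3`, where the section of record's factor VANISHES, ★ (a-10c) honest scope).  THEOREMS ONLY (no `def`, no `instance`, no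
notation, no named-fact hypothesis, no `sorry`; default heartbeats); lane `--supports stmt-HodgeConjecture-24833 --as helper` (count-neutral).  CLOSES NO SOCKET: this is the
archimedean half of `hA32` for the SHIFTED witness ★ p864245 `archSectionShifted` (its big-cell weight is ★ `archShiftFactor_bigCell_zeta` × ★ `archSectionE_midBlock_bigCell`); the
(V)∕(R)′ consumers still have to re-key `hA32` to this weight at the finite level of record (S8-R192: `K′ = ι_f(K(𝔫))`, `ω = 1`).

THE MATHEMATICS (census §1–§4).  At `t = 0` and `β² = B²` (`|ζ|² = A² + B²t² = q`): `archUnitaryValue (2p+1) 0 ζ·((2+ζ)∕ζ)^p·q^{−3∕2} = (2+ζ)^p ∕ (ζ·ζ̄^{p+2})` (§5 bridge), whose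
`t`-integral is ★ (γ1) `integral_shiftKernel_zero = (−1)^{p+1}π∕(2A^{p+2}|β|)`; so the rotation `κ = (−1)^{p+1}·conj ε` gives `Re(κ·∫ θ·q^{−3∕2}) = ‖ε‖²π∕(2A^{p+2}|β|) > 0` at EVERY
`r` (`A = 1 + r²∕2 ≥ 1`) — the `hpos` of the ★ (a-10) engine; a negative odd exponent `−(2q+1)` with the conjugate twist is the SAME weight at `−β` (`conj ζ(β) = ζ(−β)`), and
`(−β)² = B²`.  The weight is jointly continuous and of modulus `≤ ‖ε‖ ≤ 1` (`|archUnitaryValue| = 1`, `‖2+ζ‖ ≤ ‖ζ‖` as `A ≥ 1`), so the engine applies verbatim.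
* §5 `zetaBar_eq_norm_sq_div`, `sq_rpow_neg_threeHalves`, `phase_twist_kernel_algebra`, **`phase_mul_twist_mul_kernel_eq`** (bridge), **`archUnitaryValue_neg_eq_flip`**,
  `conj_twist_eq_flip`, **`re_rotated_integral_shifted_pos`** (per place, every `r`, every `p`).
* §6 `continuous_archUnitaryValue_zero_comp`, `continuous_phaseLetter₂`, **`continuous_shiftedWeight`**, **`norm_shiftedWeight_le`**, HEAD **`arch_integral_ne_zero_shifted`**.
HONEST LABEL: HC_CM is proved only modulo the 7 printed citations (2 remaining named inputs: hLiu418 = `stmt-HodgeConjecture-24832`, h413 = `stmt-HodgeConjecture-24833`) until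
rung 0 closes; REL ≠ ★ ≠ BUILT; this file asserts no named fact and closes no socket ((V)(iii) `hA32` for a general block = this × ★ `archSectionShifted_midBlock_bigCell` × the
`m_w` table × the finite half, at finite level); count-neutral.

## References
* [MoeglinWaldspurger1995] C. Mœglin, J.-L. Waldspurger, *Spectral Decomposition and Eisenstein Series* (1995): II.1.7, IV.1.11.
* [Langlands1976] R. P. Langlands, *On the Functional Equations Satisfied by Eisenstein Series*, LNM 544 (1976): Appendix (rank one).
* [Patrikis2019] S. Patrikis, *Variations on a theorem of Tate*, Mem. AMS 258 (2019): §2.1 (unitary archimedean types).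
-/

set_option autoImplicit false
set_option linter.dupNamespace false -- the mandated namespace repeats `HodgeConjecture.HodgeConjecture`

noncomputable section

open MeasureTheory MeasureTheory.Measure NumberField NumberField.InfinitePlace Filter Set
open scoped Topology ComplexConjugate
open Literature.NumberTheory.GaloisRepresentations (archUnitaryValue norm_archUnitaryValue)
open Summit.HodgeConjecture.HodgeConjecture.Cruxes.H413
open Summit.HodgeConjecture.HodgeConjecture.Cruxes.H413.K2E1ChiArchBetaNonvanishingU3 (base_pos)
open Summit.HodgeConjecture.HodgeConjecture.Cruxes.H413.K2E1ChiArchNonvanishingPhaseWeightsU3 (norm_phaseLetter_pos ofReal_cpow_neg_threeHalves)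
open Summit.HodgeConjecture.HodgeConjecture.Cruxes.H413.K2E1ChiArchNonvanishingOfRecordU3 (archUnitaryValue_natCast_zero archUnitaryValue_neg_natCast_zero)
open Summit.HodgeConjecture.HodgeConjecture.Cruxes.H413.K2E1ChiArchNonvanishingAssemblyU3 (integral_integral_prodWeight_mul_arch_cpow_neg_ne_zero)
open Summit.HodgeConjecture.HodgeConjecture.Cruxes.H413.K2E1ChiArchShiftedKernelIntegralU3

namespace Summit.HodgeConjecture.HodgeConjecture.Cruxes.H413.K2E1ChiArchShiftedNonvanishingU3

/-! ## §5 The bridge to the weight of record and the per-place ROTATED POSITIVITY -/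

section Bridge

variable {A B β : ℝ}

/-- `conj ζ = ‖ζ‖² ∕ ζ`. [folklore] -/
theorem zetaBar_eq_norm_sq_div (hA : A ≠ 0) (β t : ℝ) : ((((-A) : ℝ) : ℂ) + (((-β) * t : ℝ) : ℂ) * Complex.I) = (((‖((((-A) : ℝ) : ℂ) + ((β * t : ℝ) : ℂ) * Complex.I)‖ ^ 2 : ℝ)) : ℂ) / ((((-A) : ℝ) : ℂ) + ((β * t : ℝ) : ℂ) * Complex.I) := by
  rw [eq_div_iff (zeta_ne_zero hA β t), ← conj_zeta, Complex.ofReal_pow, ← Complex.mul_conj', mul_comm]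

/-- `(‖ζ‖²)^{−3∕2} = (‖ζ‖³)⁻¹` (real powers). [folklore] -/
theorem sq_rpow_neg_threeHalves {N : ℝ} (hN : 0 ≤ N) : (N ^ 2) ^ (-(3 / 2 : ℝ)) = (N ^ 3)⁻¹ := by
  rw [Real.rpow_neg (sq_nonneg N), ← Real.rpow_natCast N 2, ← Real.rpow_mul hN, ← Real.rpow_natCast N 3]
  norm_num

/-- Pure algebra behind the bridge: `(z∕N)^{2p+1}·(X∕z)^p·(N³)⁻¹ = X^p·(z·(N²∕z)^{p+2})⁻¹` (`z, N ≠ 0`). [folklore] -/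
theorem phase_twist_kernel_algebra {z N X : ℂ} (hz : z ≠ 0) (hN : N ≠ 0) (p : ℕ) :
    (z / N) ^ (2 * p + 1) * (X / z) ^ p * (N ^ 3)⁻¹ = X ^ p * (z * (N ^ 2 / z) ^ (p + 2))⁻¹ := by
  have ha : z ^ p ≠ 0 := pow_ne_zero _ hz
  have hb : N ^ p ≠ 0 := pow_ne_zero _ hN
  -- isolate the symbolic powers `z^p`, `N^p` as atoms
  have h1 : (z / N) ^ (2 * p + 1) = (z ^ p * z ^ p * z) / (N ^ p * N ^ p * N) := by
    rw [div_pow, show 2 * p + 1 = p + p + 1 by ring, pow_succ, pow_add, pow_succ, pow_add]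
  have h2 : (X / z) ^ p = X ^ p / z ^ p := div_pow _ _ _
  have h3 : (N ^ 2 / z) ^ (p + 2) = (N ^ p * N ^ p * N ^ 4) / (z ^ p * z ^ 2) := by
    rw [div_pow, pow_add, pow_add, ← pow_mul, show 2 * p = p + p by ring, pow_add]
    ring
  rw [h1, h2, h3]
  field_simp

/-- **THE BRIDGE**: `archUnitaryValue (2p+1) 0 ζ · ((2+ζ)∕ζ)^p · (A² + B²t²)^{−3∕2} = (2+ζ)^p ∕ (ζ·ζ̄^{p+2})` for `β² = B²` (`|ζ|² = A² + B²t²`). [cite: Patrikis2019, §2.1] -/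
theorem phase_mul_twist_mul_kernel_eq (hA : 0 < A) (hβ : β ^ 2 = B ^ 2) (p : ℕ) (t : ℝ) :
    archUnitaryValue ((2 * p + 1 : ℕ) : ℤ) 0 ((((-A) : ℝ) : ℂ) + ((β * t : ℝ) : ℂ) * Complex.I) * (((2 : ℂ) + ((((-A) : ℝ) : ℂ) + ((β * t : ℝ) : ℂ) * Complex.I)) / ((((-A) : ℝ) : ℂ) + ((β * t : ℝ) : ℂ) * Complex.I)) ^ p * (((A ^ 2 + B ^ 2 * t ^ 2 : ℝ) : ℂ) ^ (-((3 / 2 : ℝ) : ℂ))) =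
      ((2 : ℂ) + ((((-A) : ℝ) : ℂ) + ((β * t : ℝ) : ℂ) * Complex.I)) ^ p * (((((-A) : ℝ) : ℂ) + ((β * t : ℝ) : ℂ) * Complex.I) * ((((-A) : ℝ) : ℂ) + (((-β) * t : ℝ) : ℂ) * Complex.I) ^ (p + 2))⁻¹ := by
  have hz := zeta_ne_zero hA.ne' β t
  have hN0 : 0 < ‖((((-A) : ℝ) : ℂ) + ((β * t : ℝ) : ℂ) * Complex.I)‖ := norm_pos_iff.2 hz
  have hN : ((‖((((-A) : ℝ) : ℂ) + ((β * t : ℝ) : ℂ) * Complex.I)‖ : ℝ) : ℂ) ≠ 0 := Complex.ofReal_ne_zero.2 hN0.ne'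
  have hq : A ^ 2 + B ^ 2 * t ^ 2 = ‖((((-A) : ℝ) : ℂ) + ((β * t : ℝ) : ℂ) * Complex.I)‖ ^ 2 := by
    rw [norm_zeta, Real.sq_sqrt (base_pos hA β t).le, hβ]
  rw [archUnitaryValue_natCast_zero, hq, ofReal_cpow_neg_threeHalves (sq_nonneg _), sq_rpow_neg_threeHalves hN0.le,
    zetaBar_eq_norm_sq_div hA.ne' β t, Complex.ofReal_inv, Complex.ofReal_pow, Complex.ofReal_pow]
  exact phase_twist_kernel_algebra hz hN p


/-- **THE SIGN FLIP**: a negative odd exponent is the positive one at `−β` — `archUnitaryValue (−n) 0 ζ(β) = archUnitaryValue n 0 ζ(−β)` and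
`(2 + conj ζ(β))∕conj ζ(β) = (2 + ζ(−β))∕ζ(−β)`. [cite: Patrikis2019, §2.1] -/
theorem archUnitaryValue_neg_eq_flip (hA : A ≠ 0) (β t : ℝ) (n : ℕ) :
    archUnitaryValue (-(n : ℤ)) 0 ((((-A) : ℝ) : ℂ) + ((β * t : ℝ) : ℂ) * Complex.I) = archUnitaryValue (n : ℤ) 0 ((((-A) : ℝ) : ℂ) + (((-β) * t : ℝ) : ℂ) * Complex.I) := by
  rw [archUnitaryValue_neg_natCast_zero (zeta_ne_zero hA β t), archUnitaryValue_natCast_zero, conj_zeta, norm_zeta, norm_zeta, neg_sq]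

/-- The conjugate twist is the twist at `−β`. [folklore] -/
theorem conj_twist_eq_flip (A β t : ℝ) : ((2 : ℂ) + conj ((((-A) : ℝ) : ℂ) + ((β * t : ℝ) : ℂ) * Complex.I)) / conj ((((-A) : ℝ) : ℂ) + ((β * t : ℝ) : ℂ) * Complex.I) = ((2 : ℂ) + ((((-A) : ℝ) : ℂ) + (((-β) * t : ℝ) : ℂ) * Complex.I)) / ((((-A) : ℝ) : ℂ) + (((-β) * t : ℝ) : ℂ) * Complex.I) := by
  rw [conj_zeta]

/-- **ROTATED POSITIVITY AT ONE PLACE (every `r`, every `p`)** — the engine's `hpos` for the shifted weight `θ = ε·archUnitaryValue (2p+1) 0 ζ·((2+ζ)∕ζ)^p`: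
`Re((−1)^{p+1}·conj ε · ∫_ℝ θ·(A² + B²t²)^{−3∕2} dt) = ‖ε‖²·π ∕ (2·A^{p+2}·|β|) > 0` (`A = 1 + r²∕2`, `β² = B² ≠ 0`). [cite: MoeglinWaldspurger1995, IV.1.11] [cite: Langlands1976, Appendix] -/
theorem re_rotated_integral_shifted_pos (hB : B ≠ 0) (hβ : β ^ 2 = B ^ 2) {ε : ℂ} (hε : ε ≠ 0) (p : ℕ) (r : ℝ) :
    0 < ((-1 : ℂ) ^ (p + 1) * conj ε * ∫ t : ℝ, ε * archUnitaryValue ((2 * p + 1 : ℕ) : ℤ) 0 ((((-(1 + r ^ 2 / 2)) : ℝ) : ℂ) + ((β * t : ℝ) : ℂ) * Complex.I) * (((2 : ℂ) + ((((-(1 + r ^ 2 / 2)) : ℝ) : ℂ) + ((β * t : ℝ) : ℂ) * Complex.I)) / ((((-(1 + r ^ 2 / 2)) : ℝ) : ℂ) + ((β * t : ℝ) : ℂ) * Complex.I)) ^ p *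
      ((((1 + r ^ 2 / 2) ^ 2 + B ^ 2 * t ^ 2 : ℝ) : ℂ) ^ (-((3 / 2 : ℝ) : ℂ)))).re := by
  have hA1 : (1 : ℝ) ≤ 1 + r ^ 2 / 2 := by nlinarith [sq_nonneg r]
  have hA0 : (0 : ℝ) < 1 + r ^ 2 / 2 := by positivity
  have hβ0 : β ≠ 0 := by
    rintro rfl
    exact hB (pow_eq_zero_iff two_ne_zero |>.1 (by rw [← hβ]; ring))
  have hpt : ∀ t : ℝ, ε * archUnitaryValue ((2 * p + 1 : ℕ) : ℤ) 0 ((((-(1 + r ^ 2 / 2)) : ℝ) : ℂ) + ((β * t : ℝ) : ℂ) * Complex.I) * (((2 : ℂ) + ((((-(1 + r ^ 2 / 2)) : ℝ) : ℂ) + ((β * t : ℝ) : ℂ) * Complex.I)) / ((((-(1 + r ^ 2 / 2)) : ℝ) : ℂ) + ((β * t : ℝ) : ℂ) * Complex.I)) ^ p *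
      ((((1 + r ^ 2 / 2) ^ 2 + B ^ 2 * t ^ 2 : ℝ) : ℂ) ^ (-((3 / 2 : ℝ) : ℂ))) = ε * (((2 : ℂ) + ((((-(1 + r ^ 2 / 2)) : ℝ) : ℂ) + ((β * t : ℝ) : ℂ) * Complex.I)) ^ p * (((((-(1 + r ^ 2 / 2)) : ℝ) : ℂ) + ((β * t : ℝ) : ℂ) * Complex.I) * ((((-(1 + r ^ 2 / 2)) : ℝ) : ℂ) + (((-β) * t : ℝ) : ℂ) * Complex.I) ^ (p + 2))⁻¹) := fun t => by
    rw [← phase_mul_twist_mul_kernel_eq hA0 hβ p t]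
    ring
  simp_rw [hpt]
  rw [integral_const_mul, integral_shiftKernel_zero hA1 hβ0 p]
  have e : (-1 : ℂ) ^ (p + 1) * conj ε * (ε * ((((-1 : ℝ) ^ (p + 1) * Real.pi / (2 * (1 + r ^ 2 / 2) ^ (p + 2) * |β|)) : ℝ) : ℂ)) =
      (((‖ε‖ ^ 2 * (Real.pi / (2 * (1 + r ^ 2 / 2) ^ (p + 2) * |β|))) : ℝ) : ℂ) := by
    have h1 : conj ε * ε = (((‖ε‖ ^ 2 : ℝ)) : ℂ) := by rw [Complex.conj_mul', Complex.ofReal_pow]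
    have h2 : ((-1 : ℂ) ^ (p + 1)) * (-1 : ℂ) ^ (p + 1) = 1 := by rw [← pow_add, ← two_mul, pow_mul, neg_one_sq, one_pow]
    calc (-1 : ℂ) ^ (p + 1) * conj ε * (ε * ((((-1 : ℝ) ^ (p + 1) * Real.pi / (2 * (1 + r ^ 2 / 2) ^ (p + 2) * |β|)) : ℝ) : ℂ))
        = (((-1 : ℂ) ^ (p + 1)) * (-1 : ℂ) ^ (p + 1)) * (conj ε * ε) * (((Real.pi / (2 * (1 + r ^ 2 / 2) ^ (p + 2) * |β|) : ℝ)) : ℂ) := by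
          push_cast; ring
      _ = _ := by rw [h1, h2, one_mul, ← Complex.ofReal_mul]
  rw [e, Complex.ofReal_re]
  have hβa : 0 < |β| := abs_pos.2 hβ0
  positivity

end Bridge

/-! ## §6 HEAD: the archimedean half of `hA32` for the SHIFTED weights of record — EVERY odd coupling exponent `m_w` -/

section Weight

variable {β : ℝ}

/-- `x ↦ archUnitaryValue m 0 (f x)` is continuous along a continuous nowhere-zero `f` (`(f∕|f|)^{n}` or `(conj f∕|f|)^{n}`). [cite: Patrikis2019, §2.1] -/
theorem continuous_archUnitaryValue_zero_comp {X : Type*} [TopologicalSpace X] {f : X → ℂ} (hf : Continuous f) (h0 : ∀ x, f x ≠ 0) (m : ℤ) :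
    Continuous fun x => archUnitaryValue m 0 (f x) := by
  have hn : Continuous fun x => ((‖f x‖ : ℝ) : ℂ) := Complex.continuous_ofReal.comp hf.norm
  have hn0 : ∀ x, ((‖f x‖ : ℝ) : ℂ) ≠ 0 := fun x => Complex.ofReal_ne_zero.2 (norm_ne_zero_iff.2 (h0 x))
  obtain ⟨n, rfl | rfl⟩ := Int.eq_nat_or_neg m
  · simp_rw [archUnitaryValue_natCast_zero]
    exact (hf.div hn hn0).pow n
  · have e : (fun x => archUnitaryValue (-(n : ℤ)) 0 (f x)) = fun x => (conj (f x) / ((‖f x‖ : ℝ) : ℂ)) ^ n :=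
      funext fun x => archUnitaryValue_neg_natCast_zero (h0 x) n
    rw [e]
    exact ((Complex.continuous_conj.comp hf).div hn hn0).pow n

/-- The phase letter `(r, t) ↦ ζ(1 + r²∕2, β, t)` is jointly continuous and never zero. [folklore] -/
theorem continuous_phaseLetter₂ (β : ℝ) : Continuous fun x : ℝ × ℝ => (((-(1 + x.1 ^ 2 / 2)) : ℝ) : ℂ) + ((β * x.2 : ℝ) : ℂ) * Complex.I := by
  fun_prop

/-- **THE SHIFTED WEIGHT IS JOINTLY CONTINUOUS in `(r, t)`** (every `m ∈ ℤ`, `p, q ∈ ℕ`). [folklore] -/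
theorem continuous_shiftedWeight (ε : ℂ) (β : ℝ) (m : ℤ) (p q : ℕ) :
    Continuous fun x : ℝ × ℝ => ε * archUnitaryValue m 0 ((((-(1 + x.1 ^ 2 / 2)) : ℝ) : ℂ) + ((β * x.2 : ℝ) : ℂ) * Complex.I) *
      (((2 : ℂ) + ((((-(1 + x.1 ^ 2 / 2)) : ℝ) : ℂ) + ((β * x.2 : ℝ) : ℂ) * Complex.I)) / ((((-(1 + x.1 ^ 2 / 2)) : ℝ) : ℂ) + ((β * x.2 : ℝ) : ℂ) * Complex.I)) ^ p *
      (((2 : ℂ) + conj ((((-(1 + x.1 ^ 2 / 2)) : ℝ) : ℂ) + ((β * x.2 : ℝ) : ℂ) * Complex.I)) / conj ((((-(1 + x.1 ^ 2 / 2)) : ℝ) : ℂ) + ((β * x.2 : ℝ) : ℂ) * Complex.I)) ^ q := by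
  have hζ := continuous_phaseLetter₂ β
  have h0 : ∀ x : ℝ × ℝ, (((-(1 + x.1 ^ 2 / 2)) : ℝ) : ℂ) + ((β * x.2 : ℝ) : ℂ) * Complex.I ≠ 0 := fun x =>
    norm_pos_iff.1 (norm_phaseLetter_pos x.1 β x.2)
  have hc0 : ∀ x : ℝ × ℝ, conj ((((-(1 + x.1 ^ 2 / 2)) : ℝ) : ℂ) + ((β * x.2 : ℝ) : ℂ) * Complex.I) ≠ 0 := fun x => (map_ne_zero _).2 (h0 x)
  exact (((continuous_const.mul (continuous_archUnitaryValue_zero_comp hζ h0 m)).mul (((continuous_const.add hζ).div hζ h0).pow p)).mul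
    (((continuous_const.add (Complex.continuous_conj.comp hζ)).div (Complex.continuous_conj.comp hζ) hc0).pow q))

/-- **THE SHIFTED WEIGHT HAS MODULUS `≤ 1`** (`‖ε‖ ≤ 1`, `|archUnitaryValue| = 1`, `‖(2+ζ)∕ζ‖ ≤ 1` as `1 + r²∕2 ≥ 1`, same for the conjugate). [folklore] -/
theorem norm_shiftedWeight_le {ε : ℂ} (hε1 : ‖ε‖ ≤ 1) (β : ℝ) (m : ℤ) (p q : ℕ) (r t : ℝ) :
    ‖ε * archUnitaryValue m 0 ((((-(1 + r ^ 2 / 2)) : ℝ) : ℂ) + ((β * t : ℝ) : ℂ) * Complex.I) * (((2 : ℂ) + ((((-(1 + r ^ 2 / 2)) : ℝ) : ℂ) + ((β * t : ℝ) : ℂ) * Complex.I)) / ((((-(1 + r ^ 2 / 2)) : ℝ) : ℂ) + ((β * t : ℝ) : ℂ) * Complex.I)) ^ p * (((2 : ℂ) + conj ((((-(1 + r ^ 2 / 2)) : ℝ) : ℂ) + ((β * t : ℝ) : ℂ) * Complex.I)) / conj ((((-(1 + r ^ 2 / 2)) : ℝ) : ℂ) + ((β * t : ℝ) : ℂ)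 * Complex.I)) ^ q‖ ≤ 1 := by
  have hA1 : (1 : ℝ) ≤ 1 + r ^ 2 / 2 := by nlinarith [sq_nonneg r]
  have hz : ((((-(1 + r ^ 2 / 2)) : ℝ) : ℂ) + ((β * t : ℝ) : ℂ) * Complex.I) ≠ 0 := norm_pos_iff.1 (norm_phaseLetter_pos r β t)
  have h1 : ‖((2 : ℂ) + ((((-(1 + r ^ 2 / 2)) : ℝ) : ℂ) + ((β * t : ℝ) : ℂ) * Complex.I)) / ((((-(1 + r ^ 2 / 2)) : ℝ) : ℂ) + ((β * t : ℝ) : ℂ) * Complex.I)‖ ≤ 1 := by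
    rw [norm_div]
    exact div_le_one_of_le₀ (norm_two_add_zeta_le hA1 β t) (norm_nonneg _)
  have h2 : ‖((2 : ℂ) + conj ((((-(1 + r ^ 2 / 2)) : ℝ) : ℂ) + ((β * t : ℝ) : ℂ) * Complex.I)) / conj ((((-(1 + r ^ 2 / 2)) : ℝ) : ℂ) + ((β * t : ℝ) : ℂ) * Complex.I)‖ ≤ 1 := by
    rw [conj_zeta, norm_div]
    exact div_le_one_of_le₀ (norm_two_add_zeta_le hA1 (-β) t) (norm_nonneg _)
  rw [norm_mul, norm_mul, norm_mul, norm_archUnitaryValue hz, mul_one, norm_pow, norm_pow]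
  exact mul_le_one₀ (mul_le_one₀ hε1 (pow_nonneg (norm_nonneg _) _) (pow_le_one₀ (norm_nonneg _) h1)) (pow_nonneg (norm_nonneg _) _)
    (pow_le_one₀ (norm_nonneg _) h2)

end Weight

section Head

variable (L : Type) [Field L] [NumberField L] [IsCMField L] {δ : L} (hδ : δ ≠ 0)
  [MeasurableSpace (InfiniteAdeleRing L)] [BorelSpace (InfiniteAdeleRing L)]
  [MeasurableSpace (InfiniteAdeleRing ↥(maximalRealSubfield L))] [BorelSpace (InfiniteAdeleRing ↥(maximalRealSubfield L))]
  (μE₁ : Measure (InfiniteAdeleRing L)) [μE₁.IsAddHaarMeasure] (μF₁ : Measure (InfiniteAdeleRing ↥(maximalRealSubfield L))) [μF₁.IsAddHaarMeasure]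

include hδ in
/-- **HEAD (γ).  THE ARCHIMEDEAN FACTOR AT `z = 3∕2` IS NON-ZERO FOR THE SHIFTED WEIGHT OF RECORD — EVERY ODD COUPLING EXPONENT.**  For constants `0 < ‖ε_w‖ ≤ 1`, signs
`β_w² = (wδ)²`, integers `m_w` and shifts `p_w, q_w ∈ ℕ` with, at every place, EITHER `m_w = 2p_w + 1 ∧ q_w = 0` OR `m_w = −(2q_w + 1) ∧ p_w = 0`, in ★ (a-3)'s iterated bytes with
`ζ_w = −(1 + ‖Ξ_w‖²∕2) + i·β_w·s_w(a)`:
`∫_{L_∞}∫_{L⁺_∞} (∏_w ε_w·archUnitaryValue m_w 0 ζ_w·((2+ζ_w)∕ζ_w)^{p_w}·((2+conj ζ_w)∕conj ζ_w)^{q_w})·ARCH₃(Ξ,a)^{−3∕2} ≠ 0`.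
This is the weight of ★ `archSectionShifted` on the big cell (★ `archShiftFactor_bigCell_zeta` × ★ `archSectionE_midBlock_bigCell`, `m_w = kμ,w − 2eη,w` odd); `p = q = 0` (`|m_w| = 1`) is
★ (a-10c) HEAD-1's unit-coupling case.  Proof: ★ (a-10) engine with §5's rotated positivity `κ_w = (−1)^{p_w+1}·conj ε_w` (negative `m_w`: the same at `−β_w`).
[cite: MoeglinWaldspurger1995, II.1.7, IV.1.11] [cite: Langlands1976, Appendix] [cite: Patrikis2019, §2.1] -/
theorem arch_integral_ne_zero_shifted (ε : InfinitePlace L → ℂ) (hε1 : ∀ w, ‖ε w‖ ≤ 1) (hε0 : ∀ w, ε w ≠ 0)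
    (β : InfinitePlace L → ℝ) (hβ : ∀ w, β w ^ 2 = (w δ) ^ 2) (m : InfinitePlace L → ℤ) (p q : InfinitePlace L → ℕ)
    (hm : ∀ w, (m w = 2 * (p w : ℤ) + 1 ∧ q w = 0) ∨ (m w = -(2 * (q w : ℤ) + 1) ∧ p w = 0)) :
    (∫ Xi : InfiniteAdeleRing L, ∫ a : InfiniteAdeleRing ↥(maximalRealSubfield L),
      (∏ w : InfinitePlace L, ε w * archUnitaryValue (m w) 0 ((((-(1 + ‖Xi w‖ ^ 2 / 2)) : ℝ) : ℂ) + ((β w * ((InfiniteAdeleRing.ringEquiv_mixedSpace ↥(maximalRealSubfield L)) a).1 ⟨w.comap (algebraMap ↥(maximalRealSubfield L) L), K2E1HeightBigCellLineFormulaU2.isReal_comap_maximalRealSubfield L w⟩ : ℝ) : ℂ) * Complex.I) * (((2 : ℂ) + ((((-(1 + ‖Xi w‖ ^ 2 / 2)) : ℝ) : ℂ) + ((β w * ((InfiniteAdeleRing.ringEquiv_mixedSpace ↥(maximalRealSubfield L)) a).1 ⟨w.comap (algebraMap ↥(maximalRealSubfield L) L), K2E1HeightBigCellLineFormulaU2.isReal_comap_maximalRealSubfield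 L w⟩ : ℝ) : ℂ) * Complex.I)) / ((((-(1 + ‖Xi w‖ ^ 2 / 2)) : ℝ) : ℂ) + ((β w * ((InfiniteAdeleRing.ringEquiv_mixedSpace ↥(maximalRealSubfield L)) a).1 ⟨w.comap (algebraMap ↥(maximalRealSubfield L) L), K2E1HeightBigCellLineFormulaU2.isReal_comap_maximalRealSubfield L w⟩ : ℝ) : ℂ) * Complex.I)) ^ p w * (((2 : ℂ) + conj ((((-(1 + ‖Xi w‖ ^ 2 / 2)) : ℝ) : ℂ) + ((β w * ((InfiniteAdeleRing.ringEquiv_mixedSpace ↥(maximalRealSubfield L)) a).1 ⟨w.comap (algebraMap ↥(maximalRealSubfield L) L), K2E1HeightBigCellLineFormulaU2.isReal_comap_maximalRealSubfield L w⟩ : ℝ) : ℂ) * Complex.I)) / conj ((((-(1 + ‖Xi w‖ ^ 2 / 2)) : ℝ) : ℂ) + ((β w * ((InfiniteAdeleRing.ringEquiv_mixedSpace ↥(maximalRealSubfield L)) a).1 ⟨w.comap (algebraMap ↥(maximalRealSubfield L) L), K2E1HeightBigCellLineFormulaU2.isReal_comap_maximalRealSubfield L w⟩ : ℝ) : ℂ)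 * Complex.I)) ^ q w) *
        ((((∏ w : InfinitePlace L, ((1 + ‖(Xi) w‖ ^ 2 / 2) ^ 2 + (w δ) ^ 2 * (((InfiniteAdeleRing.ringEquiv_mixedSpace ↥(maximalRealSubfield L)) a).1 ⟨w.comap (algebraMap ↥(maximalRealSubfield L) L), K2E1HeightBigCellLineFormulaU2.isReal_comap_maximalRealSubfield L w⟩) ^ 2))) : ℝ) : ℂ) ^ (-(3 / 2 : ℂ)) ∂μF₁ ∂μE₁) ≠ 0 := by
  have h := integral_integral_prodWeight_mul_arch_cpow_neg_ne_zero L hδ μE₁ μF₁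
    (fun w r t => ε w * archUnitaryValue (m w) 0 ((((-(1 + r ^ 2 / 2)) : ℝ) : ℂ) + ((β w * t : ℝ) : ℂ) * Complex.I) * (((2 : ℂ) + ((((-(1 + r ^ 2 / 2)) : ℝ) : ℂ) + ((β w * t : ℝ) : ℂ) * Complex.I)) / ((((-(1 + r ^ 2 / 2)) : ℝ) : ℂ) + ((β w * t : ℝ) : ℂ) * Complex.I)) ^ p w * (((2 : ℂ) + conj ((((-(1 + r ^ 2 / 2)) : ℝ) : ℂ) + ((β w * t : ℝ) : ℂ) * Complex.I)) / conj ((((-(1 + r ^ 2 / 2)) : ℝ) : ℂ) + ((β w * t : ℝ) : ℂ) * Complex.I)) ^ q w)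
    (fun w => continuous_shiftedWeight (ε w) (β w) (m w) (p w) (q w)) (fun w r t => norm_shiftedWeight_le (hε1 w) (β w) (m w) (p w) (q w) r t)
    (σ := 3 / 2) (by norm_num) fun w => ?_
  · rw [show (((3 / 2 : ℝ)) : ℂ) = (3 / 2 : ℂ) by push_cast; ring] at h
    exact h
  · have hB : w δ ≠ 0 := (InfinitePlace.pos_iff.2 hδ).ne'
    rcases hm w with ⟨h1, h2⟩ | ⟨h1, h2⟩
    · -- positive odd exponent `m_w = 2p_w + 1`, no conjugate twist
      have h1' : m w = ((2 * p w + 1 : ℕ) : ℤ) := by rw [h1]; push_cast; ring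
      refine ⟨(-1 : ℂ) ^ (p w + 1) * conj (ε w), fun r => ?_⟩
      simp only [h1', h2, pow_zero, mul_one]
      exact re_rotated_integral_shifted_pos hB (hβ w) (hε0 w) (p w) r
    · -- negative odd exponent `m_w = −(2q_w + 1)`: the same weight at `−β_w`
      have h1' : m w = -(((2 * q w + 1 : ℕ) : ℤ)) := by rw [h1]; push_cast; ring
      have hβ' : (-β w) ^ 2 = (w δ) ^ 2 := by rw [neg_sq]; exact hβ w
      refine ⟨(-1 : ℂ) ^ (q w + 1) * conj (ε w), fun r => ?_⟩
      have hA : (1 + r ^ 2 / 2 : ℝ) ≠ 0 := by positivity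
      simp only [h1', h2, pow_zero, mul_one, archUnitaryValue_neg_eq_flip hA, conj_twist_eq_flip]
      exact re_rotated_integral_shifted_pos hB hβ' (hε0 w) (q w) r

end Head

end Summit.HodgeConjecture.HodgeConjecture.Cruxes.H413.K2E1ChiArchShiftedNonvanishingU3

end
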